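import Literature.AnabelianGeometry.EtaleTheta.Discharge.Sec2InertiaOfCommutatorAxis
import HarnessLib

/-!
# [EtTh] §2 over §1: the per-`l` inertia clauses for ALL `l > 0` are ONE `l`-free clause — the converse
# of the commutator-axis bridge AT THE HEISENBERG QUOTIENT `Δ^Θ_X = Δ_X/[Δ_X,[Δ_X,Δ_X]]`

S. Mochizuki, *The étale theta function and its Frobenioid-theoretic manifestations*, Publ. RIMS **45**
(2009) [EtTh], §1 p. 12 and §2, discussion preceding Def. 2.1, p. 35 (printed 261): «`Δ^Θ_X :=
Δ_X/[Δ_X,[Δ_X,Δ_X]]` … `1 → Δ_Θ → Δ^Θ_X → Δ^ell_X → 1`», «let `l ≥ 1` … `Δ^Θ_X ↠ Δ̄_X` …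
`1 → Δ̄_Θ → Δ̄_X → Δ̄^ell_X → 1`», «`D_x → Π^Θ_X` … maps the inertia group `I_x ⊆ D_x` isomorphically onto
`Δ_Θ`» [cite: MochizukiEtTh2009, Def 2.1 p.35].

Cell abc-iut, layer L2; seat abc-iut-w6-d059 (gen 3); row R205 of abc-iut-L2-lead «CONVERSE: per-`l` form
for all `l` ⇒ commutator-axis form at the Heisenberg quotient».  PROOF-ONLY (0 definitions); imports
abc-iut-L2-t10's `Sec2InertiaOfCommutatorAxis` (p434006: commutator axis ⇒ per-`l` clause
`toHat(I_x) ⊔ barKerHat l = barThetaHat l` for every `l > 0`, the reduced form of the binder `hIx`, p432830).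
Pure profinite group theory inside `Π_X = D.PiHat`:

* §1 `iInf_barKerHat_eq_closure` / `iInf_barThetaHat_eq_closure`: `⨅_{l>0} Ker(Δ_X ↠ Δ̄_X) =
  [Δ_X,[Δ_X,Δ_X]]⁻`, `⨅_{l>0} (Δ̄_Θ-preimage) = [Δ_X,Δ_X]⁻` (an open normal `U ⊴ Π_X` of index `m` contains
  `deltaHatPow m`; a point in `A ⊔ U` for every open normal `U` lies in `A⁻`).
* §2 `forall_sup_barKerHat_eq_iff`: a COMPACT `H ≤ Π_X` satisfies `H ⊔ barKerHat l = barThetaHat l` for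
  every `l > 0` IFF `H ⊔ [Δ_X,[Δ_X,Δ_X]]⁻ = [Δ_X,Δ_X]⁻` («`H` maps onto `Δ_Θ ⊆ Δ^Θ_X`»; ⇒ by compactness over
  the directed family `barKerHat (l·l') ≤ barKerHat l`, ⇐ since `H · barKerHat l` is closed).  So the
  per-`l` family sees a compact `H` only through its `Δ^Θ_X`-image: `H := [Δ_X,Δ_X]⁻` satisfies every
  per-`l` clause (`commutatorClosure_sup_barKerHat`) — the converse cannot hold on the nose.
* §3 `closure_zpowers_commutator_sup_closure_eq`: `⟨[a,b]⟩⁻ ⊔ [Δ_X,[Δ_X,Δ_X]]⁻ = [Δ_X,Δ_X]⁻` for ANY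
  topological generating pair; `forall_sup_barKerHat_eq_iff_sameThetaImage`: per-`l` for all `l > 0` ⟺
  SAME IMAGE AS `⟨[a,b]⟩⁻` IN `Δ^Θ_X` — the converse at the Heisenberg quotient; §4 the same at a cusp with
  compact `D_x` (`inertiaClause_forall_iff_closure`, `inertiaClause_forall_iff_sameThetaImage`).  The
  tempered form «`toTheta(I_x) = Ker((Π^tp_X)^Θ ↠ (Π^tp_X)^ell)`» is the sequel `Sec2InertiaClauseThetaLevel`.

Every clause is a HYPOTHESIS on the abstract `ThetaSetting`; no model is claimed to satisfy any; no new
`Prop` fact, no definition, no edit of another seat's file; no side taken on [IUTchIII] Cor. 3.12.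
-/

noncomputable section

namespace Literature.AnabelianGeometry.EtaleTheta

open scoped commutatorElement Pointwise
open _root_.Topology Literature.AnabelianGeometry.SemiGraphs

namespace ThetaSetting

variable {p : ℕ} [Fact p.Prime] (D : ThetaSetting p)

/-! ## §0. Two profinite generalities -/

section Profinite

variable {G : Type*} [Group G] [TopologicalSpace G] [IsTopologicalGroup G] [CompactSpace G]
  [TotallyDisconnectedSpace G]

/-- In a profinite group, an element lying in `A · U` for every open normal subgroup `U` lies in the
closure of the subgroup `A` (the open normal subgroups form a basis of neighbourhoods of `1`).
[cite: MochizukiEtTh2009, Def 2.1 p.35] -/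
theorem mem_topologicalClosure_of_forall_openNormalSubgroup (A : Subgroup G) {g : G}
    (h : ∀ U : OpenNormalSubgroup G, g ∈ A ⊔ (U : Subgroup G)) : g ∈ A.topologicalClosure := by
  change g ∈ closure (A : Set G)
  rw [mem_closure_iff]
  intro W hW hgW
  have hV : IsOpen ((fun u : G => g * u) ⁻¹' W) := hW.preimage (continuous_const_mul g)
  have h1 : (1 : G) ∈ (fun u : G => g * u) ⁻¹' W := by simpa using hgW
  obtain ⟨U, hU⟩ := ProfiniteGrp.exist_openNormalSubgroup_sub_open_nhds_of_one hV h1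
  obtain ⟨a, ha, u, hu, hau⟩ := Subgroup.mem_sup_of_normal_right.mp (h U)
  refine ⟨a, ?_, ha⟩
  have hu' : u⁻¹ ∈ ((U : Subgroup G) : Set G) := (U : Subgroup G).inv_mem hu
  have hmem : g * u⁻¹ ∈ W := hU hu'
  have hag : a = g * u⁻¹ := by rw [← hau, mul_inv_cancel_right]
  rwa [hag]

omit [TotallyDisconnectedSpace G] in
/-- An open subgroup of a compact group has positive index. [cite: MochizukiEtTh2009, Def 2.1 p.35] -/
theorem index_pos_of_isOpen' (U : Subgroup G) (hU : IsOpen (U : Set G)) : 0 < U.index := by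
  haveI : DiscreteTopology (G ⧸ U) := QuotientGroup.discreteTopology hU
  haveI : Finite (G ⧸ U) := finite_of_compact_of_discrete
  exact Nat.pos_of_ne_zero U.index_ne_zero_of_finite

end Profinite

/-! ## §1. `⨅_{l>0} Ker(Δ_X ↠ Δ̄_X) = [Δ_X,[Δ_X,Δ_X]]⁻` and `⨅_{l>0} barThetaHat = [Δ_X,Δ_X]⁻` -/

/-- `deltaHatPow (l·l') ≤ deltaHatPow l` (`y^{l l'} = (y^{l'})^l`). [cite: MochizukiEtTh2009, Def 2.1 p.35] -/
theorem deltaHatPow_mul_le (l l' : ℕ) : D.deltaHatPow (l * l') ≤ D.deltaHatPow l := by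
  refine Subgroup.normalClosure_mono ?_
  rintro _ ⟨y, hy, rfl⟩
  exact ⟨y ^ l', D.DeltaHat.pow_mem hy l', by rw [← pow_mul, mul_comm]⟩

/-- `barKerHat (l·l') ≤ barKerHat l`: the family `Ker(Δ_X ↠ Δ̄_X)` is DIRECTED along divisibility.
[cite: MochizukiEtTh2009, Def 2.1 p.35] -/
theorem barKerHat_mul_le (l l' : ℕ) : D.barKerHat (l * l') ≤ D.barKerHat l :=
  Subgroup.topologicalClosure_mono (sup_le_sup_left (D.deltaHatPow_mul_le l l') _)

/-- `barKerHat (l·l') ≤ barKerHat l'`. [cite: MochizukiEtTh2009, Def 2.1 p.35] -/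
theorem barKerHat_mul_le' (l l' : ℕ) : D.barKerHat (l * l') ≤ D.barKerHat l' := by
  rw [mul_comm]; exact D.barKerHat_mul_le l' l

/-- Every normal subgroup `U ⊴ Π_X` contains `deltaHatPow [Π_X : U]` (`y ^ [Π_X : U] ∈ U`).
[cite: MochizukiEtTh2009, Def 2.1 p.35] -/
theorem deltaHatPow_index_le (U : Subgroup D.PiHat) [U.Normal] : D.deltaHatPow U.index ≤ U := by
  refine Subgroup.normalClosure_le_normal ?_
  rintro _ ⟨y, -, rfl⟩
  exact U.pow_index_mem y

/-- For an OPEN normal `U ⊴ Π_X`: `Ker(Δ_X ↠ Δ̄_X)` at level `l := [Π_X : U]` lies in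
`[Δ_X,[Δ_X,Δ_X]] · U` (an open, hence closed, subgroup). [cite: MochizukiEtTh2009, Def 2.1 p.35] -/
theorem barKerHat_index_le (U : Subgroup D.PiHat) [U.Normal] (hU : IsOpen (U : Set D.PiHat)) :
    D.barKerHat U.index ≤ ⁅⁅D.DeltaHat, D.DeltaHat⁆, D.DeltaHat⁆ ⊔ U :=
  Subgroup.topologicalClosure_minimal _ (sup_le_sup_left (D.deltaHatPow_index_le U) _)
    (Subgroup.isClosed_of_isOpen _ (Subgroup.isOpen_mono le_sup_right hU))

/-- Same for the `Δ̄_Θ`-preimage: `barThetaHat [Π_X : U] ≤ [Δ_X,Δ_X] · U`. [cite: MochizukiEtTh2009, Def 2.1 p.35] -/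
theorem barThetaHat_index_le (U : Subgroup D.PiHat) [U.Normal] (hU : IsOpen (U : Set D.PiHat)) :
    D.barThetaHat U.index ≤ ⁅D.DeltaHat, D.DeltaHat⁆ ⊔ U :=
  Subgroup.topologicalClosure_minimal _ (sup_le_sup_left (D.deltaHatPow_index_le U) _)
    (Subgroup.isClosed_of_isOpen _ (Subgroup.isOpen_mono le_sup_right hU))

/-- **`⨅_{l>0} Ker(Δ_X ↠ Δ̄_X) = [Δ_X,[Δ_X,Δ_X]]⁻`**: the intersection over all `l ≥ 1` of the kernels
of `Δ_X ↠ Δ̄_X` is the kernel of `Δ_X ↠ Δ^Θ_X` (closure of the triple commutator) — `Π_X` is profinite.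
[cite: MochizukiEtTh2009, Def 2.1 p.35] -/
theorem iInf_barKerHat_eq_closure :
    ⨅ (l : ℕ) (_ : 0 < l), D.barKerHat l = (⁅⁅D.DeltaHat, D.DeltaHat⁆, D.DeltaHat⁆).topologicalClosure := by
  haveI : CompactSpace D.PiHat := D.isProfiniteCompletion_toHat.compactSpace
  haveI : TotallyDisconnectedSpace D.PiHat := D.isProfiniteCompletion_toHat.totallyDisconnectedSpace
  refine le_antisymm (fun g hg => ?_) (le_iInf₂ fun l _ => D.tripleCommutatorClosure_le_barKerHat l)
  refine mem_topologicalClosure_of_forall_openNormalSubgroup _ fun U => ?_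
  have hl : 0 < (U : Subgroup D.PiHat).index := index_pos_of_isOpen' _ U.isOpen
  exact D.barKerHat_index_le (U : Subgroup D.PiHat) U.isOpen ((Subgroup.mem_iInf.mp
    ((Subgroup.mem_iInf.mp hg) _)) hl)

/-- **`⨅_{l>0} barThetaHat l = [Δ_X,Δ_X]⁻`**: the intersection of the `Δ̄_Θ`-preimages is the
`Δ_Θ`-preimage `Ker(Δ_X ↠ Δ^ell_X)`. [cite: MochizukiEtTh2009, Def 2.1 p.35] -/
theorem iInf_barThetaHat_eq_closure :
    ⨅ (l : ℕ) (_ : 0 < l), D.barThetaHat l = (⁅D.DeltaHat, D.DeltaHat⁆).topologicalClosure := by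
  haveI : CompactSpace D.PiHat := D.isProfiniteCompletion_toHat.compactSpace
  haveI : TotallyDisconnectedSpace D.PiHat := D.isProfiniteCompletion_toHat.totallyDisconnectedSpace
  refine le_antisymm (fun g hg => ?_) (le_iInf₂ fun l _ => D.commutatorClosure_le_barThetaHat l)
  refine mem_topologicalClosure_of_forall_openNormalSubgroup _ fun U => ?_
  have hl : 0 < (U : Subgroup D.PiHat).index := index_pos_of_isOpen' _ U.isOpen
  exact D.barThetaHat_index_le (U : Subgroup D.PiHat) U.isOpen ((Subgroup.mem_iInf.mp
    ((Subgroup.mem_iInf.mp hg) _)) hl)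

/-- `[Δ_X,[Δ_X,Δ_X]]⁻ ≤ [Δ_X,Δ_X]⁻`. [cite: MochizukiEtTh2009, Def 2.1 p.35] -/
theorem tripleCommutatorClosure_le_commutatorClosure :
    (⁅⁅D.DeltaHat, D.DeltaHat⁆, D.DeltaHat⁆).topologicalClosure ≤
      (⁅D.DeltaHat, D.DeltaHat⁆).topologicalClosure := by
  haveI := D.deltaHat_normal'
  exact Subgroup.topologicalClosure_mono (Subgroup.commutator_le_left _ _)

/-- `[Δ_X,[Δ_X,Δ_X]]⁻` is normal in `Π_X`. [cite: MochizukiEtTh2009, Def 2.1 p.35] -/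
theorem tripleCommutatorClosure_normal :
    ((⁅⁅D.DeltaHat, D.DeltaHat⁆, D.DeltaHat⁆).topologicalClosure).Normal := by
  haveI := D.deltaHat_normal'
  exact Subgroup.is_normal_topologicalClosure _

/-! ## §2. A compact `H` satisfies every per-`l` clause iff `H ⊔ [Δ_X,[Δ_X,Δ_X]]⁻ = [Δ_X,Δ_X]⁻` -/

/-- **Compactness step**: for a compact subgroup `H ≤ Π_X`,
`⋂_{l>0} (H · Ker(Δ_X ↠ Δ̄_X)_l) ≤ H · ⋂_{l>0} Ker(Δ_X ↠ Δ̄_X)_l` — the non-empty compact sets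
`{h ∈ H | h⁻¹ g ∈ barKerHat l}` form a directed family (`barKerHat (l·l') ≤ barKerHat l, barKerHat l'`).
[cite: MochizukiEtTh2009, Def 2.1 p.35] -/
theorem iInf_sup_barKerHat_le (H : Subgroup D.PiHat) (hH : IsCompact (H : Set D.PiHat)) :
    ⨅ (l : ℕ) (_ : 0 < l), (H ⊔ D.barKerHat l) ≤ H ⊔ ⨅ (l : ℕ) (_ : 0 < l), D.barKerHat l := by
  haveI : T2Space D.PiHat := D.isProfiniteCompletion_toHat.t2Space
  intro g hg
  let S : {l : ℕ // 0 < l} → Set D.PiHat := fun l => (H : Set D.PiHat) ∩ {h | h⁻¹ * g ∈ D.barKerHat l.1}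
  have hSne : ∀ l, (S l).Nonempty := by
    rintro ⟨l, hl⟩
    haveI := D.barKerHat_normal l
    have hgl : g ∈ H ⊔ D.barKerHat l := (Subgroup.mem_iInf.mp ((Subgroup.mem_iInf.mp hg) l)) hl
    obtain ⟨h, hh, k, hk, hhk⟩ := Subgroup.mem_sup_of_normal_right.mp hgl
    refine ⟨h, hh, ?_⟩
    change h⁻¹ * g ∈ D.barKerHat l
    rw [← hhk, inv_mul_cancel_left]
    exact hk
  have hSclosed : ∀ l, IsClosed (S l) := fun l =>
    hH.isClosed.inter ((D.isClosed_barKerHat l.1).preimage ((continuous_inv).mul continuous_const))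
  have hScpt : ∀ l, IsCompact (S l) := fun l =>
    hH.of_isClosed_subset (hSclosed l) Set.inter_subset_left
  have hdir : Directed (· ⊇ ·) S := by
    rintro ⟨l, hl⟩ ⟨l', hl'⟩
    refine ⟨⟨l * l', Nat.mul_pos hl hl'⟩, ?_, ?_⟩
    · rintro h ⟨hh, hk⟩; exact ⟨hh, D.barKerHat_mul_le l l' hk⟩
    · rintro h ⟨hh, hk⟩; exact ⟨hh, D.barKerHat_mul_le' l l' hk⟩
  obtain ⟨h, hh⟩ :=
    IsCompact.nonempty_iInter_of_directed_nonempty_isCompact_isClosed S hdir hSne hScpt hSclosed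
  have hhH : h ∈ H := (Set.mem_iInter.mp hh ⟨1, one_pos⟩).1
  have hN : h⁻¹ * g ∈ ⨅ (l : ℕ) (_ : 0 < l), D.barKerHat l :=
    Subgroup.mem_iInf.mpr fun l => Subgroup.mem_iInf.mpr fun hl => (Set.mem_iInter.mp hh ⟨l, hl⟩).2
  have hg' : g = h * (h⁻¹ * g) := by rw [mul_inv_cancel_left]
  rw [hg']
  exact Subgroup.mul_mem_sup hhH hN

/-- **(⇐), for every `l`**: if a compact `H ≤ Π_X` maps onto `Δ_Θ ⊆ Δ^Θ_X`
(`H ⊔ [Δ_X,[Δ_X,Δ_X]]⁻ = [Δ_X,Δ_X]⁻`), then `H ⊔ barKerHat l = barThetaHat l` (`H · barKerHat l` is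
closed and contains `[Δ_X,Δ_X]` and `deltaHatPow l`). [cite: MochizukiEtTh2009, Def 2.1 p.35] -/
theorem sup_barKerHat_eq_of_sup_closure_eq (H : Subgroup D.PiHat) (hH : IsCompact (H : Set D.PiHat))
    (hE : H ⊔ (⁅⁅D.DeltaHat, D.DeltaHat⁆, D.DeltaHat⁆).topologicalClosure =
      (⁅D.DeltaHat, D.DeltaHat⁆).topologicalClosure) (l : ℕ) :
    H ⊔ D.barKerHat l = D.barThetaHat l := by
  haveI := D.barKerHat_normal l
  have hHle : H ≤ (⁅D.DeltaHat, D.DeltaHat⁆).topologicalClosure := le_sup_left.trans hE.le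
  refine le_antisymm (sup_le (hHle.trans (D.commutatorClosure_le_barThetaHat l))
    (D.barKerHat_le_barThetaHat l)) ?_
  have hclosed : IsClosed ((H ⊔ D.barKerHat l : Subgroup D.PiHat) : Set D.PiHat) := by
    rw [Subgroup.mul_normal]
    exact (D.isClosed_barKerHat l).mul_left_of_isCompact hH
  refine Subgroup.topologicalClosure_minimal _ (sup_le ?_ ?_) hclosed
  · exact ((Subgroup.le_topologicalClosure _).trans hE.ge).trans
      (sup_le_sup_left (D.tripleCommutatorClosure_le_barKerHat l) _)
  · exact (D.deltaHatPow_le_barKerHat l).trans le_sup_right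

/-- **(⇒)**: if a compact `H ≤ Π_X` satisfies `H ⊔ barKerHat l = barThetaHat l` for every `l > 0`, then
`H ⊔ [Δ_X,[Δ_X,Δ_X]]⁻ = [Δ_X,Δ_X]⁻` (§1 + the compactness step). [cite: MochizukiEtTh2009, Def 2.1 p.35] -/
theorem sup_closure_eq_of_forall_sup_barKerHat_eq (H : Subgroup D.PiHat)
    (hH : IsCompact (H : Set D.PiHat)) (h : ∀ l, 0 < l → H ⊔ D.barKerHat l = D.barThetaHat l) :
    H ⊔ (⁅⁅D.DeltaHat, D.DeltaHat⁆, D.DeltaHat⁆).topologicalClosure =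
      (⁅D.DeltaHat, D.DeltaHat⁆).topologicalClosure := by
  refine le_antisymm (sup_le ?_ D.tripleCommutatorClosure_le_commutatorClosure) ?_
  · rw [← D.iInf_barThetaHat_eq_closure]
    exact le_iInf₂ fun l hl => le_sup_left.trans (h l hl).le
  · rw [← D.iInf_barThetaHat_eq_closure, ← D.iInf_barKerHat_eq_closure]
    refine le_trans (le_iInf₂ fun l hl => ?_) (D.iInf_sup_barKerHat_le H hH)
    exact (iInf₂_le l hl).trans (h l hl).ge

/-- **A compact `H ≤ Π_X` satisfies the per-`l` clause for EVERY `l > 0` iff it maps onto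
`Δ_Θ ⊆ Δ^Θ_X`**: `(∀ l > 0, H ⊔ barKerHat l = barThetaHat l) ↔ H ⊔ [Δ_X,[Δ_X,Δ_X]]⁻ = [Δ_X,Δ_X]⁻`.
[cite: MochizukiEtTh2009, Def 2.1 p.35] -/
theorem forall_sup_barKerHat_eq_iff (H : Subgroup D.PiHat) (hH : IsCompact (H : Set D.PiHat)) :
    (∀ l, 0 < l → H ⊔ D.barKerHat l = D.barThetaHat l) ↔
      H ⊔ (⁅⁅D.DeltaHat, D.DeltaHat⁆, D.DeltaHat⁆).topologicalClosure =
        (⁅D.DeltaHat, D.DeltaHat⁆).topologicalClosure :=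
  ⟨D.sup_closure_eq_of_forall_sup_barKerHat_eq H hH,
    fun hE l _ => D.sup_barKerHat_eq_of_sup_closure_eq H hH hE l⟩

/-- **The per-`l` family does not pin down `H` beyond its `Δ^Θ_X`-image**: `H := [Δ_X,Δ_X]⁻` (the whole
`Δ_Θ`-preimage, NOT a procyclic commutator axis in general) satisfies `H ⊔ barKerHat l = barThetaHat l`
for every `l`. [cite: MochizukiEtTh2009, Def 2.1 p.35] -/
theorem commutatorClosure_sup_barKerHat (l : ℕ) :
    (⁅D.DeltaHat, D.DeltaHat⁆).topologicalClosure ⊔ D.barKerHat l = D.barThetaHat l := by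
  haveI : CompactSpace D.PiHat := D.isProfiniteCompletion_toHat.compactSpace
  exact D.sup_barKerHat_eq_of_sup_closure_eq _ (Subgroup.isClosed_topologicalClosure _).isCompact
    (sup_eq_left.mpr D.tripleCommutatorClosure_le_commutatorClosure) l

/-- More generally: every compact `H` with `⟨anything mapping onto Δ_Θ⟩ ≤ H ≤ [Δ_X,Δ_X]⁻` — here any
compact `H` between a compact `H₀` mapping onto `Δ_Θ` and `[Δ_X,Δ_X]⁻` — satisfies all per-`l` clauses.
[cite: MochizukiEtTh2009, Def 2.1 p.35] -/
theorem forall_sup_barKerHat_eq_of_le_of_le {H₀ H : Subgroup D.PiHat} (hH : IsCompact (H : Set D.PiHat))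
    (h₀ : H₀ ⊔ (⁅⁅D.DeltaHat, D.DeltaHat⁆, D.DeltaHat⁆).topologicalClosure =
      (⁅D.DeltaHat, D.DeltaHat⁆).topologicalClosure)
    (h₀H : H₀ ≤ H) (hH₂ : H ≤ (⁅D.DeltaHat, D.DeltaHat⁆).topologicalClosure) (l : ℕ) :
    H ⊔ D.barKerHat l = D.barThetaHat l :=
  D.sup_barKerHat_eq_of_sup_closure_eq H hH
    (le_antisymm (sup_le hH₂ D.tripleCommutatorClosure_le_commutatorClosure)
      (h₀.ge.trans (sup_le_sup_right h₀H _))) l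

/-! ## §3. The converse AT THE HEISENBERG QUOTIENT: same `Δ^Θ_X`-image as the commutator axis -/

/-- **`⟨[a,b]⟩⁻ ⊔ [Δ_X,[Δ_X,Δ_X]]⁻ = [Δ_X,Δ_X]⁻`** for ANY topological generating pair `a, b` of `Δ_X`:
the closed procyclic subgroup generated by `[a,b]` maps onto `Δ_Θ ⊆ Δ^Θ_X` (abc-iut-L2-t10's per-`l`
theorem `closure_zpowers_commutator_sup_barKerHat` for every `l > 0`, then §2).
[cite: MochizukiEtTh2009, Def 2.1 p.35] -/
theorem closure_zpowers_commutator_sup_closure_eq {a b : D.DeltaHat}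
    (hdense : (Subgroup.closure ({a, b} : Set D.DeltaHat)).topologicalClosure = ⊤) :
    (Subgroup.zpowers (⁅(a : D.PiHat), (b : D.PiHat)⁆)).topologicalClosure ⊔
        (⁅⁅D.DeltaHat, D.DeltaHat⁆, D.DeltaHat⁆).topologicalClosure =
      (⁅D.DeltaHat, D.DeltaHat⁆).topologicalClosure := by
  haveI : CompactSpace D.PiHat := D.isProfiniteCompletion_toHat.compactSpace
  exact D.sup_closure_eq_of_forall_sup_barKerHat_eq _ (Subgroup.isClosed_topologicalClosure _).isCompact
    fun l hl => D.closure_zpowers_commutator_sup_barKerHat l hl hdense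

/-- **Converse at the Heisenberg quotient**: a compact `H ≤ Π_X` satisfies the per-`l` clause for every
`l > 0` IFF `H` and the commutator axis `⟨[a,b]⟩⁻` (any topological generating pair `a, b` of `Δ_X`)
have the same image in `Δ^Θ_X = Δ_X/[Δ_X,[Δ_X,Δ_X]]`. [cite: MochizukiEtTh2009, Def 2.1 p.35] -/
theorem forall_sup_barKerHat_eq_iff_sameThetaImage (H : Subgroup D.PiHat)
    (hH : IsCompact (H : Set D.PiHat)) {a b : D.DeltaHat}
    (hdense : (Subgroup.closure ({a, b} : Set D.DeltaHat)).topologicalClosure = ⊤) :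
    (∀ l, 0 < l → H ⊔ D.barKerHat l = D.barThetaHat l) ↔
      H ⊔ (⁅⁅D.DeltaHat, D.DeltaHat⁆, D.DeltaHat⁆).topologicalClosure =
        (Subgroup.zpowers (⁅(a : D.PiHat), (b : D.PiHat)⁆)).topologicalClosure ⊔
          (⁅⁅D.DeltaHat, D.DeltaHat⁆, D.DeltaHat⁆).topologicalClosure := by
  rw [D.forall_sup_barKerHat_eq_iff H hH, D.closure_zpowers_commutator_sup_closure_eq hdense]

/-! ## §4. At the cusp (compact decomposition group `D_x`) -/

/-- For a compact decomposition group, `toHat(I_x) ≤ Π_X` is compact. [cite: MochizukiEtTh2009, Def 2.1 p.35] -/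
theorem isCompact_map_inertia (x : D.Pt) (hcpt : IsCompact (D.decomp x : Set D.PiTemp)) :
    IsCompact (((D.inertia x).map D.toHat.toMonoidHom : Subgroup D.PiHat) : Set D.PiHat) := by
  rw [Subgroup.coe_map]
  exact (hcpt.of_isClosed_subset (D.isClosed_inertia x) fun g hg => hg.1).image D.toHat.continuous

/-- **Per-`l` for all `l > 0` ⟺ ONE `l`-free clause** (compact `D_x`): the inertia clauses
`toHat(I_x) ⊔ barKerHat l = barThetaHat l` hold for every `l > 0` iff
`toHat(I_x) ⊔ [Δ_X,[Δ_X,Δ_X]]⁻ = [Δ_X,Δ_X]⁻` — «`I_x` maps ONTO `Δ_Θ ⊆ Δ^Θ_X`» inside `Π_X`.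
[cite: MochizukiEtTh2009, Def 2.1 p.35] -/
theorem inertiaClause_forall_iff_closure (x : D.Pt) (hcpt : IsCompact (D.decomp x : Set D.PiTemp)) :
    (∀ l, 0 < l → (D.inertia x).map D.toHat.toMonoidHom ⊔ D.barKerHat l = D.barThetaHat l) ↔
      (D.inertia x).map D.toHat.toMonoidHom ⊔
          (⁅⁅D.DeltaHat, D.DeltaHat⁆, D.DeltaHat⁆).topologicalClosure =
        (⁅D.DeltaHat, D.DeltaHat⁆).topologicalClosure :=
  D.forall_sup_barKerHat_eq_iff _ (D.isCompact_map_inertia x hcpt)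

/-- **Converse at the Heisenberg quotient, at the cusp**: for a compact `D_x` and ANY topological
generating pair `a, b` of `Δ_X`, the per-`l` inertia clauses for all `l > 0` hold iff `toHat(I_x)` and
`⟨[a,b]⟩⁻` have the same image in `Δ^Θ_X` (abc-iut-L2-t10's bridge p434006 is the special case
`toHat(I_x) = ⟨[a,b]⟩⁻`). [cite: MochizukiEtTh2009, Def 2.1 p.35] -/
theorem inertiaClause_forall_iff_sameThetaImage (x : D.Pt) (hcpt : IsCompact (D.decomp x : Set D.PiTemp))
    {a b : D.DeltaHat} (hdense : (Subgroup.closure ({a, b} : Set D.DeltaHat)).topologicalClosure = ⊤) :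
    (∀ l, 0 < l → (D.inertia x).map D.toHat.toMonoidHom ⊔ D.barKerHat l = D.barThetaHat l) ↔
      (D.inertia x).map D.toHat.toMonoidHom ⊔
          (⁅⁅D.DeltaHat, D.DeltaHat⁆, D.DeltaHat⁆).topologicalClosure =
        (Subgroup.zpowers (⁅(a : D.PiHat), (b : D.PiHat)⁆)).topologicalClosure ⊔
          (⁅⁅D.DeltaHat, D.DeltaHat⁆, D.DeltaHat⁆).topologicalClosure :=
  D.forall_sup_barKerHat_eq_iff_sameThetaImage _ (D.isCompact_map_inertia x hcpt) hdense

end ThetaSetting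

end Literature.AnabelianGeometry.EtaleTheta

end
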